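import Summits.BirchSwinnertonDyer.Rank1Residual.P2.ShuZhaiTwoFiftySixCurve
import HarnessLib

/-!
# Cell `bsd-print-cf2` (D-0131 (2) PRINT TIER, leaf CornerF @ `p = 2`), typer ty2 (discharge
# interface) — file 2/2 for the Shu–Zhai door at `256c1`: the ADMISSIBLE PRIMES (Def 1.1) and the
# `ℚ(√M)`-condition of Thm 1.4 (ii) / Thm 4.10, DISCHARGED for `q ≡ 5 (mod 8)` and `#Q` even

HONEST FRAMING (cell `bsd-print-cf2`, HOME `run/shared/lean/pub/bsd-print-cf2/`, verbatim in every
file): the partition leaf is `CornerF W 2` — `W/ℚ` globally minimal elliptic WITH CM and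
`ord_{s=1} L(E,s) = 1`, at the prime `2` (rung leaf `WAllCornerFTwo`; OPEN AS A CLASS). Nothing
class-wide is closed here; no named fact is introduced. Companion of `P2/ShuZhaiTwoFiftySixCurve.lean`
(file 1/2: the curve `E₀ = 256c1 : y² = x³ + 2x` in the setting of Shu–Zhai Thm 1.2; HONEST FRAMING and
context there) on the exact pattern of prover p3's `P2/ShuZhaiThirtySixAdmissible.lean` (base `36a1`). This
file turns the two remaining NUMBER-THEORETIC hypotheses of the Shu–Zhai family at `256c1` into
congruences (lit g3 DOSSIER §16.1 rows S6, S7):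

* **admissible primes** (Def 1.1: `(q, 2N) = 1`, `q` inert in `ℚ(E₀[2])` and in `ℚ(E₀′[2])`): for
  `E₀ = 256c1`, `ℚ(E₀[2]) = ℚ(√Δ_{E₀}) = ℚ(√−2)` (`Δ = −512 = −2·16²`, `d = −8`) and
  `ℚ(E₀′[2]) = ℚ(√Δ_{E₀′}) = ℚ(√2)` (`Δ′ = 2¹⁵ = 2·128²`, `d = 8` by `disc(1, √2) = 8 = r²d_F` and
  Stickelberger), and `q` is inert in both iff `(−8/q) = (8/q) = −1` iff `q ≡ 5 (mod 8)` —
  `isAdmissible_curve256c1` (the list `5, 13, 29, 37, 53, 61, 101, 109, …`);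
* **hypothesis (ii) of Thm 1.4 at `ℚ(√M)`** ("every prime of `2N` splits in `ℚ(√M)`", `M = ∏ q*`): for
  `Q` a finite set of primes `≡ 5 (mod 8)` one has `q* = q`, `M = ∏ q` squarefree `≡ 1 (mod 4)`,
  `d_{ℚ(√M)} = M` (p3's `discr_eq_of_sq_eq_of_squarefree`), and `2` (the only prime of `2N ∣ 2⁹`) splits
  iff `M ≡ 1 (mod 8)` iff `#Q` is EVEN — `allPrimesSplitInSqrt_two_mul_conductorNorm_prod_curve256c1`.
  So Thm 4.10's `ord₂(L′(E₀^{(−pM)},1)/(ΩR)) = #Q` is even on this family.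

Tools: the decomposition law and its inert case (tree `satisfiesHeegnerHypothesis_iff_kronecker`,
`RingClass.isPrime_span_natCast_iff_jacobiSym_eq_neg_one`), Euler's evaluation of `(a/q)` by
`q mod 4|a|` (tree `Quadratic.legendreSym_eq_jacobiSym_mod_four_mul`), the index formula
`disc(1, θ) = r² d_F` (tree `Quadratic.exists_discr_basisOneSqrt_eq_sq_mul_discr`) and the class-number-one
discriminant table (tree `discr_eq_of_sq_eq_intCast`, row `−8`). Beyond-print: NO.

References: [ShuZhai2021] Def 1.1, Thm 1.4 (ii), Thm 4.10 (arXiv:2102.11808 pp. 3, 13); [Cox2013] §1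
Lemma 1.14, §5.B Prop 5.16; [Marcus1977] Ch. 2 Thm 1 and Exercise 27(c), Ch. 3 Thm 25; HOME/DOSSIER.md §16.1.
-/

noncomputable section

open scoped Classical

open WeierstrassCurve NumberField Literature.NumberTheory.EllipticCurves
  Literature.NumberTheory.EllipticCurves.Rank1Residual
  Literature.NumberTheory.EllipticCurves.ModularForms
  Literature.NumberTheory.EllipticCurves.ShuZhai2021
  Summit.BirchSwinnertonDyer.Rank1Residual

set_option autoImplicit false

namespace Summit.BirchSwinnertonDyer.Rank1Residual.P2

/-! ## §1 The admissible primes of `256c1` (Def 1.1): every prime `q ≡ 5 (mod 8)`; and the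
`ℚ(√M)`-condition of Thm 1.4 (ii) for `M = ∏ q`, `#Q` even (`M ≡ 1 (mod 8)`) -/

section Admissible

open scoped NumberTheorySymbols

open Literature.NumberTheory.QuadraticFields Literature.NumberTheory.EllipticCurves.Quadratic

/-- **`ℚ(E₀[2]) = ℚ(√Δ_{E₀}) = ℚ(√−2)`, of discriminant `−8`**: a quadratic number field containing
`√−512 = 16√−2` has `d_F = −8` (tree `discr_eq_of_sq_eq_intCast`, row `−8`).
[cite: Marcus1977, Ch. 2 Thm. 1] -/
theorem discr_eq_neg_eight_of_sq_eq_Δ_curve256c1 {F : Type} [Field F] [NumberField F]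
    (h2 : Module.finrank ℚ F = 2) {x : F} (hx : x ^ 2 = algebraMap ℚ F curve256c1.Δ) :
    NumberField.discr F = -8 := by
  rw [curve256c1_Δ] at hx
  refine discr_eq_of_sq_eq_intCast h2 (θ := x / 8) ?_ (by decide)
  rw [div_pow, hx]
  push_cast
  norm_num

/-- `2` is not a perfect square. [folklore] -/
private theorem not_isSquare_two' : ¬ IsSquare (2 : ℕ) := by
  rintro ⟨r, hr⟩
  have : r ≤ 2 := by nlinarith
  interval_cases r <;> omega

/-- No square of a rational number is `2`. [folklore] -/
private theorem not_sq_eq_two' (q : ℚ) : q ^ 2 ≠ 2 := by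
  intro h
  have h2 : IsSquare ((2 : ℕ) : ℚ) := ⟨q, by push_cast; rw [← h]; ring⟩
  exact not_isSquare_two' (Rat.isSquare_natCast_iff.mp h2)

/-- **`ℚ(E₀′[2]) = ℚ(√Δ_{E₀′}) = ℚ(√2)`, of discriminant `8`**: a quadratic number field containing
`√32768 = 128√2` has `d_F = 8` (`disc(1, √2) = 8 = r²·d_F` with `d_F ≡ 0, 1 (mod 4)` forces `r² = 1`).
[cite: Marcus1977, Ch. 2 Thm. 1 and Exercise 27(c)] -/
theorem discr_eq_eight_of_sq_eq_Δ_curve256c1' {F : Type} [Field F] [NumberField F]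
    (h2 : Module.finrank ℚ F = 2) {x : F}
    (hx : x ^ 2 = algebraMap ℚ F (⟨0, 0, 0, -8, 0⟩ : WeierstrassCurve ℚ).Δ) : NumberField.discr F = 8 := by
  rw [curve256c1'_Δ] at hx
  set θ : F := x / 128 with hθdef
  have hθ2 : θ ^ 2 = 2 := by
    rw [hθdef, div_pow, hx]; norm_num
  have hrel : θ ^ 2 + algebraMap ℚ F 0 * θ + algebraMap ℚ F (-2) = 0 := by
    simp [hθ2]
  have hθ : θ ∉ Set.range (algebraMap ℚ F) := by
    rintro ⟨q, hq⟩
    apply not_sq_eq_two' q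
    have h3 : algebraMap ℚ F (q ^ 2) = algebraMap ℚ F 2 := by rw [map_pow, hq, hθ2]; norm_num
    exact (algebraMap ℚ F).injective h3
  have hint : IsIntegral ℤ θ := by
    refine ⟨Polynomial.X ^ 2 - Polynomial.C 2, ?_, ?_⟩
    · exact Polynomial.monic_X_pow_sub_C _ two_ne_zero
    · simp [hθ2]
  obtain ⟨r, hr0, hr⟩ := Quadratic.exists_discr_basisOneSqrt_eq_sq_mul_discr h2 hθ hint
  rw [Quadratic.discr_basisOneSqrt_of_quadratic h2 hθ hrel] at hr
  have hrZ : (8 : ℤ) = r ^ 2 * NumberField.discr F := by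
    have : ((8 : ℤ) : ℚ) = ((r ^ 2 * NumberField.discr F : ℤ) : ℚ) := by push_cast; linarith
    exact_mod_cast this
  -- `d_F ≡ 0, 1 (mod 4)` (Stickelberger, from an integral basis `(1, ω)`)
  obtain ⟨b, hb⟩ := Quadratic.exists_basis_zero_eq_one h2
  have hd4 := Quadratic.discr_eq_sq_add_four_mul b hb
  set d := NumberField.discr F with hd
  set t := b.repr (b 1 * b 1) 1
  set m := b.repr (b 1 * b 1) 0
  -- `r² ∣ 8`, `r ≠ 0` ⇒ `r² ∈ {1, 4}`; `r² = 4` would give `d = 2 = t² + 4m`, impossible mod `4`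
  set n := r.natAbs with hn
  have hr2n : r ^ 2 = (n : ℤ) ^ 2 := (Int.natAbs_sq r).symm
  have hn0 : n ≠ 0 := fun h => hr0 (Int.natAbs_eq_zero.mp h)
  have hdpos : 0 < d := by
    by_contra hle
    have : r ^ 2 * d ≤ 0 := mul_nonpos_of_nonneg_of_nonpos (sq_nonneg r) (not_lt.mp hle)
    omega
  have hnle : n ≤ 2 := by
    have h1 : (n : ℤ) ^ 2 ≤ 8 := by
      rw [← hr2n]
      calc r ^ 2 = r ^ 2 * 1 := (mul_one _).symm
        _ ≤ r ^ 2 * d := mul_le_mul_of_nonneg_left (by omega) (sq_nonneg r)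
        _ = 8 := hrZ.symm
    have h2' : (n : ℤ) ≤ 2 := by nlinarith
    omega
  rw [hr2n] at hrZ
  interval_cases n
  · exact absurd rfl hn0
  · norm_num at hrZ; exact hrZ.symm
  · exfalso
    norm_num at hrZ
    have hd2 : t ^ 2 + 4 * m = 2 := by rw [← hd4]; omega
    have h4 : ((t ^ 2 + 4 * m : ℤ) : ZMod 4) = ((2 : ℤ) : ZMod 4) := by rw [hd2]
    push_cast at h4
    rw [show (4 : ZMod 4) = 0 from rfl, zero_mul, add_zero] at h4
    exact absurd h4 (by generalize (t : ZMod 4) = z; revert z; decide)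

/-- `J(−8 | q) = −1` for a prime `q ≡ 5 (mod 8)` (`(−2/q) = 1 ⟺ q ≡ 1, 3 (mod 8)`). [cite: Cox2013, §1 Lemma 1.14] -/
private theorem jacobiSym_neg_eight_eq_neg_one {q : ℕ} (hq : q.Prime) (h8 : q % 8 = 5) :
    J(-8 | q) = -1 := by
  haveI := Fact.mk hq
  have hq2 : q ≠ 2 := by rintro rfl; norm_num at h8
  rw [← jacobiSym.legendreSym.to_jacobiSym, Quadratic.legendreSym_eq_jacobiSym_mod_four_mul hq2]
  norm_num
  rcases (by omega : q % 32 = 5 ∨ q % 32 = 13 ∨ q % 32 = 21 ∨ q % 32 = 29) with h | h | h | h <;>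
    rw [h] <;> norm_num

/-- `J(8 | q) = −1` for a prime `q ≡ 5 (mod 8)` (`(2/q) = 1 ⟺ q ≡ 1, 7 (mod 8)`). [cite: Cox2013, §1 Lemma 1.14] -/
private theorem jacobiSym_eight_eq_neg_one {q : ℕ} (hq : q.Prime) (h8 : q % 8 = 5) : J(8 | q) = -1 := by
  haveI := Fact.mk hq
  have hq2 : q ≠ 2 := by rintro rfl; norm_num at h8
  rw [← jacobiSym.legendreSym.to_jacobiSym, Quadratic.legendreSym_eq_jacobiSym_mod_four_mul hq2]
  norm_num
  rcases (by omega : q % 32 = 5 ∨ q % 32 = 13 ∨ q % 32 = 21 ∨ q % 32 = 29) with h | h | h | h <;>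
    rw [h] <;> norm_num

/-- **Every prime `q ≡ 5 (mod 8)` is ADMISSIBLE for `256c1`** (Def 1.1: `(q, 2N) = 1` — `2N` is a power
of `2` —, `q` inert in `ℚ(E₀[2]) = ℚ(√−2)` and in `ℚ(E₀′[2]) = ℚ(√2)`, i.e. `(−8/q) = (8/q) = −1`): the
list `5, 13, 29, 37, 53, 61, 101, 109, …` of lit g3's DOSSIER §16.1 row S6.
[cite: ShuZhai2021, Def. 1.1 (arXiv:2102.11808 p. 3)] [cite: Cox2013, §5.B Prop. 5.16] -/
theorem isAdmissible_curve256c1 {q : ℕ} (hq : q.Prime) (h8 : q % 8 = 5) :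
    IsAdmissible curve256c1 (⟨0, 0, 0, -8, 0⟩ : WeierstrassCurve ℚ) q := by
  have hq2 : q ≠ 2 := by rintro rfl; norm_num at h8
  refine ⟨hq, ?_, ?_, ?_⟩
  · -- `(q, 2N) = 1`: `2N ∣ 2⁹`
    exact (((Nat.coprime_primes hq Nat.prime_two).mpr hq2).pow_right 9).coprime_dvd_right
      two_mul_conductorNorm_curve256c1_dvd
  · intro F _ _ h2 hx
    obtain ⟨x, hx⟩ := hx
    rw [Int.cast_natCast]
    exact (RingClass.isPrime_span_natCast_iff_jacobiSym_eq_neg_one h2 hq hq2).mpr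
      (by rw [discr_eq_neg_eight_of_sq_eq_Δ_curve256c1 h2 hx]; exact jacobiSym_neg_eight_eq_neg_one hq h8)
  · intro F _ _ h2 hx
    obtain ⟨x, hx⟩ := hx
    rw [Int.cast_natCast]
    exact (RingClass.isPrime_span_natCast_iff_jacobiSym_eq_neg_one h2 hq hq2).mpr
      (by rw [discr_eq_eight_of_sq_eq_Δ_curve256c1' h2 hx]; exact jacobiSym_eight_eq_neg_one hq h8)

/-- The `Q`-clause of the setting of Thm 1.2 at `256c1` for a finite set of primes `q ≡ 5 (mod 8)` and
`p ≡ 7 (mod 8)` (so `q ≠ p`). [cite: ShuZhai2021, Thm. 1.2 and Def. 1.1] -/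
theorem admissible_curve256c1_of_forall_mod_eight {p : ℕ} (h8 : p % 8 = 7) {Q : Finset ℕ}
    (hQ : ∀ q ∈ Q, q.Prime ∧ q % 8 = 5) :
    ∀ q ∈ Q, IsAdmissible curve256c1 (⟨0, 0, 0, -8, 0⟩ : WeierstrassCurve ℚ) q ∧ q ≠ p :=
  fun q hq => ⟨isAdmissible_curve256c1 (hQ q hq).1 (hQ q hq).2, by
    have h5 := (hQ q hq).2
    rintro rfl
    omega⟩

end Admissible

/-! ### The `ℚ(√M)`-condition of Thm 1.4 (ii) / Thm 4.10 for `M = ∏_{q ∈ Q} q`, `q ≡ 5 (mod 8)`, `#Q` even -/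

/-- For primes `q ≡ 1 (mod 4)`, `∏ q* = ∏ q`. [cite: ShuZhai2021, §1 (arXiv:2102.11808 p. 3)] -/
theorem prod_qStar_eq_of_forall_mod_eight {Q : Finset ℕ} (hQ : ∀ q ∈ Q, q.Prime ∧ q % 8 = 5) :
    (∏ q ∈ Q, qStar q : ℤ) = ((∏ q ∈ Q, q : ℕ) : ℤ) := by
  rw [Nat.cast_prod]
  exact Finset.prod_congr rfl fun q hq => qStar_of_mod_four_eq_one (by have := (hQ q hq).2; omega)

/-- A product of DISTINCT primes is squarefree. [folklore] -/
private theorem squarefree_prod_primes' {Q : Finset ℕ} (hQ : ∀ q ∈ Q, q.Prime) :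
    Squarefree (∏ q ∈ Q, q) := by
  classical
  induction Q using Finset.induction_on with
  | empty => simp
  | insert a s ha ih =>
    rw [Finset.prod_insert ha]
    have hap : a.Prime := hQ a (Finset.mem_insert_self a s)
    have hs : ∀ q ∈ s, q.Prime := fun q hq => hQ q (Finset.mem_insert_of_mem hq)
    refine (Nat.squarefree_mul ?_).mpr ⟨hap.squarefree, ih hs⟩
    refine (Nat.Coprime.prod_right fun q hq => (Nat.coprime_primes hap (hs q hq)).mpr ?_)
    rintro rfl
    exact ha hq

/-- A product of an EVEN number of primes `≡ 5 (mod 8)` is `≡ 1 (mod 8)`; of an odd number, `≡ 5 (mod 8)`.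
[folklore] -/
theorem prod_mod_eight_of_forall_mod_eight {Q : Finset ℕ} (hQ : ∀ q ∈ Q, q.Prime ∧ q % 8 = 5) :
    (∏ q ∈ Q, q) % 8 = if Q.card % 2 = 0 then 1 else 5 := by
  classical
  induction Q using Finset.induction_on with
  | empty => simp
  | insert a s ha ih =>
    have hs : ∀ q ∈ s, q.Prime ∧ q % 8 = 5 := fun q hq => hQ q (Finset.mem_insert_of_mem hq)
    have ha5 : a % 8 = 5 := (hQ a (Finset.mem_insert_self a s)).2
    rw [Finset.prod_insert ha, Finset.card_insert_of_notMem ha, Nat.mul_mod, ha5, ih hs]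
    by_cases h : s.card % 2 = 0
    · rw [if_pos h, if_neg (by omega)]
    · rw [if_neg h, if_pos (by omega)]

/-- **Hypothesis (ii) of Thm 1.4 at `ℚ(√M)`: every prime of `2N` splits in `ℚ(√M)`** for
`M = ∏_{q∈Q} q*` with `Q` a finite set of primes `q ≡ 5 (mod 8)` of EVEN cardinality (`M ≡ 1 (mod 8)`;
for `Q = ∅`, `M = 1` and the condition is empty): `2N` is a power of `2` and `d_{ℚ(√M)} = M ≡ 1 (mod 8)`.
So Thm 4.10's `ord₂(L′(E₀^{(−pM)},1)/(ΩR)) = #Q` is EVEN on this family.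
[cite: ShuZhai2021, Thm. 1.4 (ii) and Thm. 4.10 (arXiv:2102.11808 pp. 3, 13)] [cite: Marcus1977, Ch. 3 Thm. 25] -/
theorem allPrimesSplitInSqrt_two_mul_conductorNorm_prod_curve256c1 {Q : Finset ℕ}
    (hQ : ∀ q ∈ Q, q.Prime ∧ q % 8 = 5) (heven : Q.card % 2 = 0) :
    AllPrimesSplitInSqrt (2 * curve256c1.conductorNorm ℤ) (∏ q ∈ Q, qStar q) := by
  rw [prod_qStar_eq_of_forall_mod_eight hQ]
  set M : ℕ := ∏ q ∈ Q, q with hMdef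
  have hM8 : M % 8 = 1 := by rw [hMdef, prod_mod_eight_of_forall_mod_eight hQ, if_pos heven]
  by_cases hM1 : M = 1
  · exact Or.inl ⟨1, by rw [hM1]; norm_num⟩
  refine Or.inr fun F _ _ h2 ⟨y, hy⟩ => ?_
  have hsq : Squarefree M := squarefree_prod_primes' fun q hq => (hQ q hq).1
  have hyM : y ^ 2 = (M : F) := by rw [hy]; push_cast; rfl
  have hD := discr_eq_of_sq_eq_of_squarefree h2 hsq hM1 (by omega) hyM
  have h512 : SatisfiesHeegnerHypothesis (2 ^ 9) F := by
    rw [satisfiesHeegnerHypothesis_iff_kronecker _ F h2, hD]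
    intro ℓ hℓ hℓN
    obtain rfl := (Nat.prime_dvd_prime_iff_eq hℓ Nat.prime_two).mp (hℓ.dvd_of_dvd_pow hℓN)
    exact ⟨fun _ => by omega, fun h2' => absurd rfl h2'⟩
  exact h512.of_dvd two_mul_conductorNorm_curve256c1_dvd

end Summit.BirchSwinnertonDyer.Rank1Residual.P2

end
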